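import Mathlib

/-!
# SoloBlind E60 — the Frobenius-branch skeleton of Conjecture V (solo-Langlands-blind, s119)

Informal THEOREM F (HOME `work/s117/tower_theory.md` §14).  Let `ℓ ≥ 5`, `ℓ ∣ p - 1`, `a = v_ℓ(p-1)`,
`q ∉ {p, ℓ}` prime with `q ≢ 1 (mod ℓ)`; `T = T(p)_𝔪` (Mazur's Eisenstein completion), `I = ηT`,
`η_q := T_q - q - 1 = θ·η`.  Then the `𝔫`-part of Ribet's module `Ω = (q-old) ∩ (q-new) ⊂ J₀(pq)`
is `(T/θT)²`, the old/new congruence module of `T(pq)` at `𝔫` is `T/θT` (Agashe–Ribet–Stein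
saturation), and the new Eisenstein depth is `μ_ℓ{p,q} = pos(θ) = length (T/I)/θ̄`, which Mazur's
`I/I²`-formula `e(T_r - r - 1) = ((r-1)/2)·log r` turns into `μ_ℓ{p,q} = v_ℓ[((ℤ/p)ˣ)_ℓ : ⟨q⟩]`
— Conjecture V on the whole Frobenius branch.

This file checks the ring-theoretic skeleton that the informal proof uses verbatim:
* `mul_mem_span_mul_iff` — cancellation of a non-zero-divisor inside a principal ideal
  (`θ·y ∈ (θη) ↔ y ∈ (η)`), used for `(T/η_q)[I] = θ·(T/η_q)` and for
  `Σ^⊥ = {y : θ·y₂ = 0 in T/θη} = T̄e₁ ⊕ ((η)/(θη))e₂`;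
* `colon_strict` — in `ℤ/ℓ^a` (`a ≥ 1`) the element `ℓ^(a-1)` is nonzero and killed by `ℓ`,
  i.e. `(I : 𝔪) ⊋ I`, which forces the Shimura generator to be unimodular;
* `depth_eq_pos` — the final bookkeeping: the E58 identity `min c_old μ = pos` with `c_old = a`,
  `pos ≤ a`, and the constant-term ceiling `μ ≤ a_p + a_q = a` give `μ = pos`.
Sources: Mazur 1977 (II.9, II.11, II.16, II.18); Ribet 1984 and Agashe–Ribet–Stein 2012 as recalled in
Yoo, arXiv:1409.8342 §3.1–3.2; Lecouturier, arXiv:1709.09114 p.12 (Mazur's formula).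
-/

namespace Summit.Langlands.Langlands.Theorems

section Cancel

variable {R : Type*} [CommRing R]

/-- Cancellation of a non-zero-divisor `θ` inside a principal ideal: `θ * y ∈ (θ * η) ↔ y ∈ (η)`. -/
theorem mul_mem_span_mul_iff {θ : R} (hθ : ∀ x : R, x * θ = 0 → x = 0) (η y : R) :
    θ * y ∈ Ideal.span ({θ * η} : Set R) ↔ y ∈ Ideal.span ({η} : Set R) := by
  constructor
  · intro h
    obtain ⟨c, hc⟩ := Ideal.mem_span_singleton'.mp h
    have h0 : (c * η - y) * θ = 0 := by
      have h' : θ * (c * η) = θ * y := by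
        calc θ * (c * η) = c * (θ * η) := by ring
          _ = θ * y := hc
      calc (c * η - y) * θ = θ * (c * η) - θ * y := by ring
        _ = 0 := by rw [h', sub_self]
    have h1 : c * η - y = 0 := hθ _ h0
    have h2 : c * η = y := sub_eq_zero.mp h1
    exact Ideal.mem_span_singleton'.mpr ⟨c, h2⟩
  · intro h
    obtain ⟨c, hc⟩ := Ideal.mem_span_singleton'.mp h
    exact Ideal.mem_span_singleton'.mpr ⟨c, by rw [← hc]; ring⟩

/-- The same cancellation with the factors of the generator swapped: `η * x ∈ (θ * η) ↔ x ∈ (θ)`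
(this is `(T/η_q)[I] = θ·(T/η_q)` for `η_q = θη`). -/
theorem mul_mem_span_mul_iff' {η : R} (hη : ∀ x : R, x * η = 0 → x = 0) (θ x : R) :
    η * x ∈ Ideal.span ({θ * η} : Set R) ↔ x ∈ Ideal.span ({θ} : Set R) := by
  have := mul_mem_span_mul_iff (R := R) hη θ x
  simpa [mul_comm] using this

/-- The annihilator statement behind `Ann_T (T/θ ⊕ T/θ) = (θ)`, in elementwise form:
`t` kills the class of `1` in `R/(θ)` iff `t ∈ (θ)`. -/
theorem mem_span_iff_mk_eq_zero (θ t : R) :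
    t ∈ Ideal.span ({θ} : Set R) ↔ (Ideal.Quotient.mk (Ideal.span ({θ} : Set R)) t = 0) := by
  rw [Ideal.Quotient.eq_zero_iff_mem]

end Cancel

section Colon

/-- `(I : 𝔪) ⊋ I` in the model `T/I = ℤ/ℓ^a`, `a ≥ 1`: the element `ℓ^(a-1)` of `ℤ/ℓ^a` is killed by `ℓ`
but is not zero.  (Forces the Shimura generator `s = θ(u e₁ + v e₂)` to have `(u,v)` unimodular.) -/
theorem colon_strict {ℓ a : ℕ} (hℓ : 1 < ℓ) (ha : 1 ≤ a) :
    ((ℓ ^ (a - 1) : ℕ) : ZMod (ℓ ^ a)) * (ℓ : ZMod (ℓ ^ a)) = 0 ∧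
      ((ℓ ^ (a - 1) : ℕ) : ZMod (ℓ ^ a)) ≠ 0 := by
  have hpow : ℓ ^ (a - 1) * ℓ = ℓ ^ a := by
    rw [← pow_succ]; congr 1; omega
  constructor
  · have : (((ℓ ^ (a - 1) * ℓ : ℕ)) : ZMod (ℓ ^ a)) = 0 := by
      rw [hpow]; exact ZMod.natCast_self (ℓ ^ a)
    simpa [Nat.cast_mul] using this
  · intro h
    rw [CharP.cast_eq_zero_iff (ZMod (ℓ ^ a)) (ℓ ^ a)] at h
    -- ℓ^a ∣ ℓ^(a-1) is impossible for ℓ > 1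
    have hlt : ℓ ^ (a - 1) < ℓ ^ a := Nat.pow_lt_pow_right hℓ (by omega)
    have hpos : 0 < ℓ ^ (a - 1) := by positivity
    exact absurd (Nat.le_of_dvd hpos h) (not_le.mpr hlt)

end Colon

section Depth

/-- (F4) bookkeeping: E58 gives `min c_old μ = pos` with `c_old = a`; `pos ≤ a`; and when `pos = a`
the constant-term ceiling `μ ≤ a_p + a_q = a` applies.  Conclusion: `μ = pos`. -/
theorem depth_eq_pos {a μ pos : ℕ} (hE58 : min a μ = pos) (hceil : pos = a → μ ≤ a) : μ = pos := by
  rcases Nat.lt_or_ge μ a with h | h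
  · have : min a μ = μ := Nat.min_eq_right (Nat.le_of_lt h)
    omega
  · have : min a μ = a := Nat.min_eq_left h
    have hpa : pos = a := by omega
    have := hceil hpa
    omega

/-- The uncensored case: if the `I/I²`-position is below the Eisenstein depth `a`, no ceiling is needed. -/
theorem depth_eq_pos_of_lt {a μ pos : ℕ} (hE58 : min a μ = pos) (hlt : pos < a) : μ = pos := by
  rcases Nat.lt_or_ge μ a with h | h
  · have : min a μ = μ := Nat.min_eq_right (Nat.le_of_lt h)
    omega
  · have : min a μ = a := Nat.min_eq_left h
    omega

/-- Frobenius-branch value of V: with `a_q = 0` (so the `q`-side covering order is `ℓ^0`) the law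
`V = a_p + a_q - max o_p o_q` of E59 reads `V = a_p - o_p = ι_p(q)` (index = group order ÷ element order). -/
theorem V_frobenius_branch (ap op : ℕ) : ap + 0 - max op 0 = ap - op := by
  simp

/-- Worked rank-one instance `(p, ℓ) = (11, 5)`, `q = 23`: `a = v_5(10) = 1`,
`|a_23(11a) - 23 - 1| = |-1 - 24| = 25`, so `R = v_5(25) - a = 1 = pos`, hence `μ_5{11,23} = 1`
(measured exactly by engine e7b, job j348385). -/
example : padicValNat 5 25 - 1 = 1 := by
  have h : padicValNat 5 (5 ^ 2) = 2 := by
    haveI : Fact (Nat.Prime 5) := ⟨by norm_num⟩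
    exact padicValNat.prime_pow 2
  norm_num at h
  omega

end Depth

end Summit.Langlands.Langlands.Theorems
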